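import Summits.ABC.IUTFork.Cor312LogKummerGlobal
import Summits.ABC.IUTFork.Cor312ThetaAdmFrames
import HarnessLib

/-!
# [IUTchIII] Cor. 3.12 — the volume-level vehicles need only `mono` + `ThetaFinite` (not `BridgeHyps`); their side
# conditions at abc-iut-c312-7's assemblers `Setting.ofComparison` / `Setting.ofFrames` from the SHAPE of the Θ-boxes

Record-only file (D-0012) of the abc-iut cell (Cor. 3.12 sub-crew, seat abc-iut-c312-6 gen 4; TEAM B «estimate /
log-Kummer» support row «(G1)-vehicle side conditions at the assembled real setting», `HOME/plan/C312-TEAMS.md` §B;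
answers B1's 2026-08-26T00:44:23Z «shorten the RESIDUAL instance obligations of the capstones at the ASSEMBLED real
setting» and A-0's 00:52:17Z leftover list `hθ`/`hfinθ`/`ThetaFinite`); PROOF-ONLY; TAKES NO SIDE.

KERNEL CENSUS CORRECTION (§1, generic over every `Cor312.Setting`). The volume-level vehicles of record —
R0 `statement_of_qLocal_le` (A1), TEAM B's `statement_of_volumeTransport` / `GlobalVolumeTransport(At).statement_of` /
`globalVolumeTransport_of_volumeTransport` / `statement_of_qFrobComparison` / `statement_of_thm311` (B1, p411119,
p411648, p414039), TEAM A's `statement_of_gapGlobal` (skel XXV) — take abc-iut-c312-6's `BridgeHyps P` wholesale, but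
consume from it ONLY `mono` (Prop. 3.9 (i) monotonicity) and `finite` (= `ThetaFinite` = the Statement's own FIRST
conjunct, ADJUDICATION-SPEC NB3). The fields `image_adm` / `image_fin` / `hul_nonempty` / `theta_nonempty` — hence the
instance residuals `hθ` «the (Ind3)-UNION `thetaRegion3` is admissible» and `hfinθ` of `bridgeHyps_of_summands` /
`bridgeHyps_DH` / `bridgeHyps_settingDHVol` — are used by the SET-level readings R1/R2/R3 only
(`Cor312StatementBridge`). abc-iut-w5-d060's `Cor312ThetaRegion3UnionNotAdm` (p416677: `not_bridgeHyps_of_separated` —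
`hθ`, hence `BridgeHyps`, FAILS over both verbatim containers as soon as two Kummer images at one multi-summand packet
are coordinate-separated) therefore does NOT touch these vehicles: this file re-derives every one of them from
`(hmono : LogvolMono P)` + `(hfin : P.ThetaFinite)` through the ONE pointwise lemma `statement_of_pointwise_of_thetaFinite`
(the landed `BridgeHyps` forms are instances, `example`s), with `ThetaRegionsAdm` (EACH Kummer image admissible — not
their union) as the only region-level side condition.

§2 At abc-iut-c312-7's assembler `Setting.ofComparison`: `ThetaRegionsAdm` ⟸ «every Θ-box of the Θ-pilot object at a
label `j ∈ 𝔽_l^⋇` is a hull-set `λ·𝒪_L`» (the printed shape, [IUTchIII] Rmk. 3.9.5 (ii)/(ix): pilot objects give arithmetic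
line bundles, i.e. hull-sets) via the assembler's own binder `hadm` — one line. §3 The same at the FRAMES SETTING OF
RECORD `Setting.ofFrames` (ADJUDICATION-SPEC §1/§4 (iii); provenance link abc-iut-c312-8 `isSettingOf_ofFrames`) over
gen-2's `FrameVolumePieces`: `LogvolMono` PROVED (gen-2 `logvolMono_ofFrames`), `ThetaRegionsAdm` ⟸ hull-set Θ-boxes
(gen-3), whence `statement_ofFrames_of_volumeTransport` / `_of_globalVolumeTransport` from {hull-set Θ-boxes,
Statement.1, B-INPUT}. Companion `Cor312SettingDHVolRoute` does the same at abc-iut-c312-5's `Real.settingDHVol`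
(verbatim weighted container, p418868); Statement.1 (`ThetaFinite`) there is abc-iut-c312-5's
`Cor312HullDefinedDHVol` / `Cor312ThetaFiniteDHVol` (p417967 / p419718: `Real.thetaFinite_settingDHVol`), with which
`Real.statement_settingDHVol_of_globalVolumeTransport` composes in one line.

Sources: [IUTchIII] kurims `paper:url-4b091feeb646` p. 173 l. 41 – p. 174 l. 19 (statement), p. 174 l. 50 – p. 175
l. 4 (hull, finiteness), p. 184 l. 30–34 ((xi-g)); Prop. 3.9 (i)–(iii) pp. 115–117. [claim: Mochizuki2012, status:
disputed] for the quoted sentences. Deliberately NOT here: any instance of the B-INPUT, any judgement. Typed ≠ proved.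
-/

noncomputable section

open Set Function

namespace Summit.ABC

namespace IUTFork

namespace Cor312Vol

open Thm311 Cor312 Literature.IUT.LogThetaLattice Literature.IUT.LogVolume

/-! ## 1. The volume-level vehicles from `LogvolMono` + `ThetaFinite` alone -/

section Generic

variable {T : ThetaIndex} {S : Situation T} {P : Cor312.Setting S}

/-- Under `ThetaFinite` (the Statement's first conjunct) every union of possible images at a label `j ∈ 𝔽_l^⋇`
admits its hull (`HullDefined`); c312-6's `hullDefined_of_finite` with the `BridgeHyps` wrapper removed. [folklore] -/
theorem hullDefined_of_thetaFinite (hfin : P.ThetaFinite) (i : Fin T.lstar) (vQ : T.VQ) :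
    P.HullDefined (Setting.labelSucc i) vQ := by
  by_contra hb
  exact hfin.1 i vQ (by unfold Setting.thetaLocal; rw [if_neg hb])

/-- Under `ThetaFinite`, the local Θ-term is the real log-volume of the packet hull. [folklore] -/
theorem thetaLocal_untopD_of_thetaFinite (hfin : P.ThetaFinite) (i : Fin T.lstar) (vQ : T.VQ) :
    (P.thetaLocal (Setting.labelSucc i) vQ).untopD 0 =
      (S.D P.n).logvol _ vQ (P.thetaHull (Setting.labelSucc i) vQ) := by
  unfold Setting.thetaLocal
  rw [if_pos (hullDefined_of_thetaFinite hfin i vQ)]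
  rfl

/-- **THE ONE POINTWISE LEMMA every volume-level vehicle factors through** (R0 of record, A1's
`statement_of_qLocal_le`, with `BridgeHyps` replaced by its only consumed field `ThetaFinite`): if in every packet
`(j = i+1, v_ℚ)` the `q`-pilot contribution is at most the hull contribution, the printed Statement holds — `∑ᶠ` over `v_ℚ`
([IUTchIII] Prop. 3.9 (iii)) and the average over `j ∈ 𝔽_l^⋇` (Prop. 3.9 (i)) are monotone. [claim: Mochizuki2012, status: disputed] -/
theorem statement_of_pointwise_of_thetaFinite (hfin : P.ThetaFinite)
    (h : ∀ (i : Fin T.lstar) (vQ : T.VQ),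
      P.qLocal (Setting.labelSucc i) vQ ≤ (P.thetaLocal (Setting.labelSucc i) vQ).untopD 0) :
    P.Statement := by
  constructor
  · unfold Setting.negLogTheta
    rw [if_pos hfin]
    exact WithTop.coe_ne_top
  · unfold Setting.negLogTheta
    rw [if_pos hfin, WithTop.coe_le_coe]
    unfold Setting.negLogQ
    refine processionNormalized_mono fun i => ?_
    exact finsum_le_finsum' (P.qSupport_finite (Setting.labelSucc i)) (hfin.2 i) fun vQ => h i vQ

/-- Per packet: under monotonicity, `ThetaFinite` and admissibility of the Kummer images, every single Kummer image
has log-volume at most the hull term (it lies in the packet hull, `thetaRegion_subset_thetaHull`).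
w4-d022's `logvol_thetaRegion_le_thetaLocal` without the `BridgeHyps` wrapper. [folklore] -/
theorem logvol_thetaRegion_le_thetaLocal_of_mono (hmono : LogvolMono P) (hfin : P.ThetaFinite)
    (hadm : ThetaRegionsAdm P) (m : ℤ) (i : Fin T.lstar) (vQ : T.VQ) :
    (S.D P.n).logvol (Setting.labelSucc i) vQ (P.thetaRegion m (Setting.labelSucc i) vQ) ≤
      (P.thetaLocal (Setting.labelSucc i) vQ).untopD 0 := by
  rw [thetaLocal_untopD_of_thetaFinite hfin]
  exact hmono i vQ (hadm m i vQ) (P.thetaHull_adm (hullDefined_of_thetaFinite hfin i vQ))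
    (thetaRegion_subset_thetaHull P m _ vQ)

/-- **B-1's log-Kummer route, `BridgeHyps`-free**: `LogvolMono` + `ThetaFinite` + `ThetaRegionsAdm` + the per-packet
B-INPUT `VolumeTransport` ⟹ the printed Statement ([IUTchIII] Cor. 3.12 via Step (xi-g) read as a volume
comparison). Nothing asserted. [claim: Mochizuki2012, status: disputed] -/
theorem statement_of_volumeTransport_of_mono (hmono : LogvolMono P) (hfin : P.ThetaFinite)
    (hadm : ThetaRegionsAdm P) (hvt : VolumeTransport P) : P.Statement :=
  statement_of_pointwise_of_thetaFinite hfin fun i vQ => by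
    obtain ⟨m, hm⟩ := hvt i vQ
    exact hm.trans (logvol_thetaRegion_le_thetaLocal_of_mono hmono hfin hadm m i vQ)

/-- … uniform form (one gluing position `m`). [claim: Mochizuki2012, status: disputed] -/
theorem statement_of_volumeTransportAt_of_mono {m : ℤ} (hmono : LogvolMono P) (hfin : P.ThetaFinite)
    (hadm : ThetaRegionsAdm P) (hvt : VolumeTransportAt P m) : P.Statement :=
  statement_of_volumeTransport_of_mono hmono hfin hadm (volumeTransport_of_at hvt)

/-- **The GLOBAL route ((G1′)-level, w4-d022 / B1 p414039), `BridgeHyps`-free**: `LogvolMono` + `ThetaFinite` +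
`ThetaRegionsAdm` + `GlobalVolumeTransport` ⟹ the printed Statement. [claim: Mochizuki2012, status: disputed] -/
theorem statement_of_globalVolumeTransport_of_mono (hmono : LogvolMono P) (hfin : P.ThetaFinite)
    (hadm : ThetaRegionsAdm P) (hgvt : GlobalVolumeTransport P) : P.Statement := by
  obtain ⟨m, hsupp, hglob⟩ := hgvt
  constructor
  · unfold Setting.negLogTheta
    rw [if_pos hfin]
    exact WithTop.coe_ne_top
  · unfold Setting.negLogTheta
    rw [if_pos hfin, WithTop.coe_le_coe]
    refine hglob.trans (processionNormalized_mono fun i => ?_)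
    exact finsum_le_finsum' (hsupp i) (hfin.2 i)
      fun vQ => logvol_thetaRegion_le_thetaLocal_of_mono hmono hfin hadm (m i vQ) i vQ

/-- … uniform form. [claim: Mochizuki2012, status: disputed] -/
theorem statement_of_globalVolumeTransportAt_of_mono {m₀ : ℤ} (hmono : LogvolMono P) (hfin : P.ThetaFinite)
    (hadm : ThetaRegionsAdm P) (h : GlobalVolumeTransportAt P m₀) : P.Statement :=
  statement_of_globalVolumeTransport_of_mono hmono hfin hadm (globalVolumeTransport_of_at h)

/-- **Per-packet ⟹ global with the support condition DERIVED** (B1's `globalVolumeTransport_of_volumeTransport`),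
`BridgeHyps`-free. [folklore] -/
theorem globalVolumeTransport_of_volumeTransport_of_mono (hmono : LogvolMono P) (hfin : P.ThetaFinite)
    (hadm : ThetaRegionsAdm P) (hvt : VolumeTransport P) : GlobalVolumeTransport P := by
  choose m hm using hvt
  have hsupp : ∀ i : Fin T.lstar, (Function.support fun vQ =>
      (S.D P.n).logvol (Setting.labelSucc i) vQ
        (P.thetaRegion (m i vQ) (Setting.labelSucc i) vQ)).Finite :=
    fun i => support_finite_of_sandwich (fun vQ => hm i vQ)
      (fun vQ => logvol_thetaRegion_le_thetaLocal_of_mono hmono hfin hadm (m i vQ) i vQ)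
      (qLocal_support_finite (Setting.labelSucc i)) (hfin.2 i)
  exact ⟨m, hsupp, globalVolumeTransport_of_pointwise m (fun i vQ => hm i vQ) hsupp⟩

/-- `BridgeHyps` supplies exactly the two consumed fields: the landed forms are instances. [folklore] -/
example (H : BridgeHyps P) (hadm : ThetaRegionsAdm P) (hvt : VolumeTransport P) : P.Statement :=
  statement_of_volumeTransport_of_mono H.mono H.finite hadm hvt

example (H : BridgeHyps P) (hadm : ThetaRegionsAdm P) (hgvt : GlobalVolumeTransport P) : P.Statement :=
  statement_of_globalVolumeTransport_of_mono H.mono H.finite hadm hgvt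

end Generic

/-! ### Layer 2: through the typed Theorem 3.11 (ii) (a) / the whole typed Theorem 3.11 -/

section Lattice

variable {T : ThetaIndex} {S' : LatticeSituation T} {P : Cor312.Setting S'.toSituation}

/-- **B1's `statement_of_qFrobComparison`, `BridgeHyps`-free**: `LogvolMono` + `ThetaFinite` + Thm. 3.11 (ii) (a)
`Column.KummerA` + `ThetaRegionsAdm` + the holomorphic-side B-INPUT `QFrobComparison` ⟹ Statement (admissibility of the
`q`-pilot image is the Setting's own `qRegionAdm_of_hul_adm`). [claim: Mochizuki2012, status: disputed] -/
theorem statement_of_qFrobComparison_of_mono (hmono : LogvolMono P) (hfin : P.ThetaFinite)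
    (hka : (S'.col P.n).KummerA (S'.D P.n)) (hadm : ThetaRegionsAdm P) (h : QFrobComparison P) :
    P.Statement :=
  statement_of_volumeTransport_of_mono hmono hfin hadm
    (volumeTransport_of_frobVolumeTransport hka hadm
      (frobVolumeTransport_of_qFrobComparison hka (qRegionAdm_of_hul_adm P) h))

/-- … printed uniform-equality form of the input. [claim: Mochizuki2012, status: disputed] -/
theorem statement_of_qFrobEqualityAt_of_mono {m : ℤ} (hmono : LogvolMono P) (hfin : P.ThetaFinite)
    (hka : (S'.col P.n).KummerA (S'.D P.n)) (hadm : ThetaRegionsAdm P) (h : QFrobEqualityAt P m) :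
    P.Statement :=
  statement_of_qFrobComparison_of_mono hmono hfin hka hadm (qFrobComparison_of_equalityAt h)

end Lattice

section Full

variable {T : ThetaIndex} {S'' : FullSituation T} {P : Cor312.Setting S''.toSituation}

/-- **B1's `statement_of_thm311`, `BridgeHyps`-free**: against the WHOLE typed Theorem 3.11 the route closes modulo
`LogvolMono`, `ThetaFinite` (= Statement.1), `ThetaRegionsAdm`, and the B-INPUT `QFrobComparison` — no
`image_adm`/`image_fin`/`theta_nonempty`/`hul_nonempty`, hence no `hθ`/`hfinθ`. [claim: Mochizuki2012, status: disputed] -/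
theorem statement_of_thm311_of_mono (hmono : LogvolMono P) (hfin : P.ThetaFinite) (h311 : S''.Statement)
    (hadm : ThetaRegionsAdm P) (h : QFrobComparison (S' := S''.toLatticeSituation) P) : P.Statement :=
  statement_of_qFrobComparison_of_mono hmono hfin (h311.2.1 P.n).1 hadm h

end Full

/-! ## 2. `ThetaRegionsAdm` at `Setting.ofComparison` from the SHAPE of the Θ-boxes -/

section OfComparison

variable {T : ThetaIndex} {S : Situation T}
  (n : ℤ) {HT : Type} {LogLink : HT → HT → Type} {IsFull : ∀ {s t : HT}, LogLink s t → Prop}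
  (lat : LGPGaussianLogThetaLattice LogLink IsFull)
  {Frd : Type} {IsoF : Frd → Frd → Type} {Ob : Frd → Type} {realify : Frd → Frd} {Strip : Type}
  {IsoS : Strip → Strip → Type} {M : ∀ v : T.V, v ∈ T.Vbad → Type} [∀ v h, Monoid (M v h)]
  (sig : GlobalLGPFrobenioidSignature T.lstar T.V (· ∈ T.Vbad) Frd IsoF Ob realify Strip IsoS M)
  (split : SplittingMonoids M) {ObΔ : Type} {N : ∀ v : T.V, v ∈ T.Vbad → Type} [∀ v h, Monoid (N v h)]
  (qData : QPilotData ObΔ N) (R : Setting.RealPieces S (Ob sig.Clgp) ObΔ)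
  (hq : ∀ j vQ i, R.qCentre (qPilotObject qData) j vQ i ≠ 0)
  (hadm : ∀ j vQ (H : Set (∀ i, R.K j vQ i)), IsHullSet (R.K j vQ) H → (S.D n).Adm j vQ (R.e j vQ ⁻¹' H))
  (hfin : ∀ j : T.Label, (Function.support fun vQ => (S.D n).logvol j vQ
    (R.e j vQ ⁻¹' hullSet (R.K j vQ) (R.qCentre (qPilotObject qData) j vQ))).Finite)

/-- **`ThetaRegionsAdm` from the shape of the Θ-boxes** at abc-iut-c312-7's assembler: if every Θ-box of the Θ-pilot
object at a label `j ∈ 𝔽_l^⋇` is a hull-set `λ·𝒪_L` of the real packet (the printed shape of pilot-object regions,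
[IUTchIII] Rmk. 3.9.5 (ii) p. 127 / (ix)), then every Kummer image `e⁻¹(Θ-box_m)` is admissible — by the assembler's
own binder `hadm` "hull-sets are admissible". [claim: Mochizuki2012, status: disputed] -/
theorem thetaRegionsAdm_ofComparison_of_isHullSet
    (hbox : ∀ (m : ℤ) (i : Fin T.lstar) (vQ : T.VQ),
      IsHullSet (R.K _ vQ) (R.thetaBox m (thetaPilotObject sig split) (Setting.labelSucc i) vQ)) :
    ThetaRegionsAdm (Setting.ofComparison n lat sig split qData R hq hadm hfin) :=
  fun m i vQ => hadm _ vQ _ (hbox m i vQ)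

/-- At the assembler, the printed Statement from {hull-set Θ-boxes, `LogvolMono`, `ThetaFinite`, B-INPUT}.
[claim: Mochizuki2012, status: disputed] -/
theorem statement_ofComparison_of_volumeTransport
    (hbox : ∀ (m : ℤ) (i : Fin T.lstar) (vQ : T.VQ),
      IsHullSet (R.K _ vQ) (R.thetaBox m (thetaPilotObject sig split) (Setting.labelSucc i) vQ))
    (hmono : LogvolMono (Setting.ofComparison n lat sig split qData R hq hadm hfin))
    (finite : (Setting.ofComparison n lat sig split qData R hq hadm hfin).ThetaFinite)
    (hvt : VolumeTransport (Setting.ofComparison n lat sig split qData R hq hadm hfin)) :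
    (Setting.ofComparison n lat sig split qData R hq hadm hfin).Statement :=
  statement_of_volumeTransport_of_mono hmono finite
    (thetaRegionsAdm_ofComparison_of_isHullSet n lat sig split qData R hq hadm hfin hbox) hvt

end OfComparison

/-! ## 3. At the frames setting of record `Setting.ofFrames` (abc-iut-c312-7; provenance abc-iut-c312-8) -/

namespace FrameVolumePieces

section Frames

variable {T : ThetaIndex} {S : Situation T} {V : FrameVolumePieces S.L} {n : ℤ}
  {HT : Type} {LogLink : HT → HT → Type} {IsFull : ∀ {s t : HT}, LogLink s t → Prop}
  (lat : LGPGaussianLogThetaLattice LogLink IsFull)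
  {Frd : Type} {IsoF : Frd → Frd → Type} {Ob : Frd → Type} {realify : Frd → Frd} {Strip : Type}
  {IsoS : Strip → Strip → Type} {M : ∀ v : T.V, v ∈ T.Vbad → Type} [∀ v h, Monoid (M v h)]
  (sig : GlobalLGPFrobenioidSignature T.lstar T.V (· ∈ T.Vbad) Frd IsoF Ob realify Strip IsoS M)
  (split : SplittingMonoids M) {ObΔ : Type} {N : ∀ v : T.V, v ∈ T.Vbad → Type} [∀ v h, Monoid (N v h)]
  (qData : QPilotData ObΔ N)
  (thetaBox : ℤ → Ob sig.Clgp → ∀ j vQ, Set (∀ i, V.K j vQ i))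
  (qCentre : ObΔ → ∀ j vQ, ∀ i, V.K j vQ i)
  (hq : ∀ j vQ i, qCentre (qPilotObject qData) j vQ i ≠ 0)
  (hadm : ∀ j vQ (H : Set (∀ i, V.K j vQ i)), IsHullSet (V.K j vQ) H → (S.D n).Adm j vQ (V.e j vQ ⁻¹' H))
  (hfin : ∀ j : T.Label, (Function.support fun vQ => (S.D n).logvol j vQ
    (V.e j vQ ⁻¹' hullSet (V.K j vQ) (qCentre (qPilotObject qData) j vQ))).Finite)

/-- **The printed Statement at the FRAMES SETTING OF RECORD** (ADJUDICATION-SPEC §1/§4 (iii): c312-7's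
`Setting.ofFrames` over a line realising gen-2's all-places container `FrameVolumePieces`) from: hull-set Θ-boxes
(gen-3 `thetaRegionsAdm_ofFrames_of_isHullSet`), `ThetaFinite` (= Statement.1) and the per-packet B-INPUT —
`LogvolMono` is PROVED here (gen-2 `logvolMono_ofFrames`); no `hθ`/`hfinθ`. [claim: Mochizuki2012, status: disputed] -/
theorem statement_ofFrames_of_volumeTransport (hV : V.Realizes (S.D n))
    (hbox : ∀ (m : ℤ) (i : Fin T.lstar) (vQ : T.VQ),
      IsHullSet (V.K _ vQ) (thetaBox m (thetaPilotObject sig split) (Setting.labelSucc i) vQ))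
    (finite : (Setting.ofFrames n lat sig split qData (V.toRealFrames thetaBox qCentre) hq hadm hfin).ThetaFinite)
    (hvt : VolumeTransport (Setting.ofFrames n lat sig split qData (V.toRealFrames thetaBox qCentre) hq hadm hfin)) :
    (Setting.ofFrames n lat sig split qData (V.toRealFrames thetaBox qCentre) hq hadm hfin).Statement :=
  statement_of_volumeTransport_of_mono (logvolMono_ofFrames lat sig split qData thetaBox qCentre hq hadm hfin hV)
    finite (thetaRegionsAdm_ofFrames_of_isHullSet lat sig split qData thetaBox qCentre hq hadm hfin hV hbox) hvt

/-- … and from the GLOBAL B-INPUT ((G1′)-level). [claim: Mochizuki2012, status: disputed] -/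
theorem statement_ofFrames_of_globalVolumeTransport (hV : V.Realizes (S.D n))
    (hbox : ∀ (m : ℤ) (i : Fin T.lstar) (vQ : T.VQ),
      IsHullSet (V.K _ vQ) (thetaBox m (thetaPilotObject sig split) (Setting.labelSucc i) vQ))
    (finite : (Setting.ofFrames n lat sig split qData (V.toRealFrames thetaBox qCentre) hq hadm hfin).ThetaFinite)
    (hgvt : GlobalVolumeTransport
      (Setting.ofFrames n lat sig split qData (V.toRealFrames thetaBox qCentre) hq hadm hfin)) :
    (Setting.ofFrames n lat sig split qData (V.toRealFrames thetaBox qCentre) hq hadm hfin).Statement :=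
  statement_of_globalVolumeTransport_of_mono
    (logvolMono_ofFrames lat sig split qData thetaBox qCentre hq hadm hfin hV) finite
    (thetaRegionsAdm_ofFrames_of_isHullSet lat sig split qData thetaBox qCentre hq hadm hfin hV hbox) hgvt

end Frames

end FrameVolumePieces

end Cor312Vol

end IUTFork

end Summit.ABC

end
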